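import Summits.HodgeConjecture.HodgeConjecture.Theorems.F0P5TP2HermAssembly
import Literature.NumberTheory.Automorphic.UnitaryCurveCotangentSpectralProjectionConj
import HarnessLib

/-!
# Crux `HLiu418` — K-LANE SUB-LINE F0-P5TP2SpectralProjection, ASSEMBLY (antiholomorphic twin): (D̄₂) AT HERMITIAN `σ_ι H`

HC_CM is proved only modulo the printed citations until rung 0 closes.  Cell `hodgecm-mathlib`, floor 0, programme P5.  From ★
`F0P5TP2HermAssembly.holCotFormSpectralProjection₂Herm_holds` (TP₂ at hermitian `σ_ι H`, unconditional) and the conjugation dictionary of ★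
`UnitaryCurveCotangentSpectralProjectionConj` (`toLp_toQuotFun_conjFun₂`, `DiscreteAutomorphicRep.starProjection_star`), this file proves

  `antiholCotFormSpectralProjection₂Herm_holds` — the body of ★ `UnitaryCurveForms.antiholCotFormSpectralProjection₂` with the single extra binder
  `(H.map (cmPlace L ι).1.embedding).IsHermitian →` after `hg` (= the (D̄₂) letter after the R1 (α-lite) in-place edition),

by the pointwise argument of ★ `antiholCotFormSpectralProjection₂_of_hol`: `pr_P [\overline{f₀}] = \overline{pr_{P̄} [f₀]} = [\overline{f₀′}]`.
THEOREMS ONLY; no definition, no instance, no `sorry`.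

## References
* [BorelJacquet1979] A. Borel, H. Jacquet, *Automorphic forms and automorphic representations*, PSPM 33.1 (1979), §4.6.
* [BorelWallach2000] A. Borel, N. Wallach, *Continuous cohomology, discrete subgroups, and representations…*, 2nd ed., VII 2.10.
-/

set_option autoImplicit false
set_option linter.dupNamespace false -- the mandated namespace repeats `HodgeConjecture.HodgeConjecture`

noncomputable section

namespace Summit.HodgeConjecture.HodgeConjecture.Cruxes.HLiu418.F0P5TP2HermAssembly

open scoped Matrix ComplexOrder
open NumberField NumberField.InfinitePlace MeasureTheory
open Literature.NumberTheory.Automorphic Literature.NumberTheory.Automorphic.UnitaryGroup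
open Literature.NumberTheory.Automorphic.UnitaryCurveForms
open Literature.NumberTheory.Automorphic.UnitaryGroup.CotangentForms (toQuotFun)
open Literature.AlgebraicGeometry.ShimuraVarieties

/-- **(D̄₂) AT HERMITIAN `σ_ι H`, UNCONDITIONALLY** — the body of ★ `UnitaryCurveForms.antiholCotFormSpectralProjection₂` with the single extra
binder `(H.map (cmPlace L ι).1.embedding).IsHermitian →` after `hg`: the spectral projection of a square-integrable cone-ANTIholomorphic cotangent
form is the class of a cone-antiholomorphic cotangent form.  From the holomorphic statement at `P̄` by complex conjugation.
[cite: BorelJacquet1979, §4.6] [cite: BorelWallach2000, VII 2.10] -/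
theorem antiholCotFormSpectralProjection₂Herm_holds :
    ∀ (L : Type) [Field L] [NumberField L] [IsCMField L] (ι : L →+* ℂ) (H : Matrix (Fin 2) (Fin 2) L)
    (dV : Fin 2 → L) (_hdV : ∀ i, IsCMField.complexConj L (dV i) = dV i) (_hdV0 : ∀ i, dV i ≠ 0)
    (t : L) (_ht : t ≠ 0) (g : GL (Fin 2) L),
    formCongr ((IsCMField.complexConj L : L ≃ₐ[↥(maximalRealSubfield L)] L) : L →+* L) g (t • H) = Matrix.diagonal dV →
    (H.map (cmPlace L ι).1.embedding).IsHermitian →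
    (∃ T : GL (Fin 2) ℂ, formCongr (starRingEnd ℂ) T ((Matrix.diagonal dV).map ι) = Matrix.diagonal ![(1 : ℂ), -1]) →
    (∀ τ' : L →+* ℂ, InfinitePlace.mk τ' ≠ InfinitePlace.mk ι → ((Matrix.diagonal dV).map τ').PosDef) →
    4 ≤ Module.finrank ℚ L →
    ∀ (𝔣 : ConeFrame L H (cmPlace L ι))
      (μ : Measure (adelicGroupData (↥(maximalRealSubfield L)) L (IsCMField.complexConj L) 2 H).automorphicQuotient)
      [(adelicGroupData (↥(maximalRealSubfield L)) L (IsCMField.complexConj L) 2 H).IsAutomorphicMeasure μ]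
      (P : DiscreteAutomorphicRep (adelicGroupData (↥(maximalRealSubfield L)) L (IsCMField.complexConj L) 2 H) μ)
      (f : (adelicGroupData (↥(maximalRealSubfield L)) L (IsCMField.complexConj L) 2 H).Adelic → ℂ),
      f ∈ (holCotForms₂ (↥(maximalRealSubfield L)) L (IsCMField.complexConj L) H (IsCMField.complexConj_ne_one L)
          (UnitaryGroup.complexConj_smul_infinitePlace L) (cmPlace L ι) 𝔣).map
        (conjFun₂ (↥(maximalRealSubfield L)) L (IsCMField.complexConj L) H) →
    ∀ hf : MemLp (toQuotFun (adelicGroupData (↥(maximalRealSubfield L)) L (IsCMField.complexConj L) 2 H) f) 2 μ,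
      ∃ f' ∈ (holCotForms₂ (↥(maximalRealSubfield L)) L (IsCMField.complexConj L) H (IsCMField.complexConj_ne_one L)
          (UnitaryGroup.complexConj_smul_infinitePlace L) (cmPlace L ι) 𝔣).map
        (conjFun₂ (↥(maximalRealSubfield L)) L (IsCMField.complexConj L) H),
        ∃ hf' : MemLp (toQuotFun (adelicGroupData (↥(maximalRealSubfield L)) L (IsCMField.complexConj L) 2 H) f') 2 μ,
          P.space.toSubmodule.starProjection
              (MemLp.toLp (toQuotFun (adelicGroupData (↥(maximalRealSubfield L)) L (IsCMField.complexConj L) 2 H) f) hf) =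
            MemLp.toLp (toQuotFun (adelicGroupData (↥(maximalRealSubfield L)) L (IsCMField.complexConj L) 2 H) f') hf' := by
  intro L _ _ _ ι H dV hdV hdV0 t ht g hg hJ hsig hpos h4 𝔣 μ _ P f hfmem hf
  obtain ⟨f₀, hf₀, rfl⟩ := Submodule.mem_map.mp hfmem
  have hf₀L : MemLp (toQuotFun (adelicGroupData (↥(maximalRealSubfield L)) L (IsCMField.complexConj L) 2 H) f₀) 2 μ :=
    (memLp_toQuotFun_conjFun₂_iff (IsCMField.complexConj L) H f₀).mp hf
  obtain ⟨f₀', hf₀', hf₀'L, heq⟩ :=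
    holCotFormSpectralProjection₂Herm_holds L ι H dV hdV hdV0 t ht g hg hJ hsig hpos h4 𝔣 μ P.conj f₀ hf₀ hf₀L
  have hf'L : MemLp (toQuotFun (adelicGroupData (↥(maximalRealSubfield L)) L (IsCMField.complexConj L) 2 H)
      (conjFun₂ (↥(maximalRealSubfield L)) L (IsCMField.complexConj L) H f₀')) 2 μ :=
    (memLp_toQuotFun_conjFun₂_iff (IsCMField.complexConj L) H f₀').mpr hf₀'L
  refine ⟨conjFun₂ (↥(maximalRealSubfield L)) L (IsCMField.complexConj L) H f₀', Submodule.mem_map_of_mem hf₀', hf'L, ?_⟩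
  rw [toLp_toQuotFun_conjFun₂ (IsCMField.complexConj L) H f₀ hf₀L hf,
    toLp_toQuotFun_conjFun₂ (IsCMField.complexConj L) H f₀' hf₀'L hf'L, DiscreteAutomorphicRep.starProjection_star, heq]

end Summit.HodgeConjecture.HodgeConjecture.Cruxes.HLiu418.F0P5TP2HermAssembly

end
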